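import Mathlib
import Literature.AlgebraicGeometry.Resolution.QuadraticTransforms
import Literature.AlgebraicGeometry.Resolution.LocalBlowup
import Literature.AlgebraicGeometry.Resolution.CompleteLocalDomainNormalization
import Summits.ResolutionOfSingularities.ResolutionOfSingularities.Theorems.RadicialJungCleanModelsCleanLU3ArcTools
import Summits.ResolutionOfSingularities.ResolutionOfSingularities.Theorems.RadicialJungCleanModelsCleanLU3CompositeInert
import HarnessLib

/-!
# Route `RadicialJung`, crux `CleanModels` (stmt-15917), sub-line (C-div) «Cdiv-small» helpers (O1, O2)

Brief `Sketch-brief-Cdiv-subline.md` §w1; worker `res-B-cdiv-w1` g0 (O1), g2 (O2).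
OURS; nothing here proves resolution in characteristic `p`.

* `locAtCentre_eq_of_DVR` — a regular local subring of dimension 1 dominated by a valuation ring of
  rank one equals it: when the localization at the centre is a DVR dominated by another DVR, they
  coincide.
* `mul_derivation_mem_of_isLocalization` — if `s · D` preserves `B` and `locAtCentre B O₁ = O₁.toSubring`,
  then `s · D` preserves `O₁` (combining `mul_derivation_mem_locAtCentre` with the equality).
* `no_best_residue_approx` — in the inert branch, every `d ∈ O₁` has an improvement `d' ∈ O₁` with
  `v(u - d'^p) < v(u - d^p)`: the defect lives on the residue field of `O₁`.
-/

noncomputable section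

set_option linter.dupNamespace false

open IsLocalRing
open Literature.AlgebraicGeometry.Resolution

namespace Summit.ResolutionOfSingularities.ResolutionOfSingularities.Theorems.RadicialJung.CleanModels

variable {K : Type} [Field K]

/-! ## O1: Equality of locAtCentre with a DVR -/

/-- **A DVR dominated by another DVR of the same field equals it.** If `B` is a local subring of `K`
which is a discrete valuation ring (regular local of dimension one) with fraction field `K`, and
`B` is dominated by a rank-one valuation ring `O` (also a DVR) of `K`, then `B = O.toSubring`.

The key is that a DVR `B` is a valuation ring, so for any `x ∈ K`, either `x ∈ B` or `x⁻¹ ∈ B`.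
If `x ∈ O` and `x⁻¹ ∈ B ⊆ O`, then `x` is a unit of `O`, and by domination `x⁻¹` is a unit of `B`,
hence `x = (x⁻¹)⁻¹ ∈ B`. [folklore] -/
theorem locAtCentre_eq_of_DVR {B : Subring K} {O : ValuationSubring K}
    (hBO : B ≤ O.toSubring) [IsRegularLocalRing B]
    (hdim : ringKrullDim B = 1) [_hr : Nonempty O.valuation.RankOne]
    (hdom : SubringDominates B O.toSubring)
    (hfrac : ∀ x : K, ∃ a ∈ B, ∃ b ∈ B, b ≠ 0 ∧ x = a / b) : B = O.toSubring := by
  -- B is a DVR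
  haveI hDVR : IsDiscreteValuationRing B :=
    isDiscreteValuationRing_of_isRegularLocalRing_of_ringKrullDim_eq_one B hdim
  -- B is a valuation ring (this instance exists by `of_isDiscreteValuationRing`)
  haveI : ValuationRing B := inferInstance
  -- Show B = O.toSubring by showing O.toSubring ⊆ B
  refine le_antisymm hBO ?_
  intro x hxO
  -- Use valuation ring property: either x ∈ B or x⁻¹ ∈ B (as elements of Frac B = K)
  obtain ⟨a, ha, b, hb, hb0, hxab⟩ := hfrac x
  by_cases hxB : x ∈ B
  · exact hxB
  · -- x ∉ B, show contradiction
    -- Since B is a valuation ring, for a, b ∈ B either a | b or b | a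
    obtain ⟨c, hc | hc⟩ := ValuationRing.cond (⟨a, ha⟩ : B) (⟨b, hb⟩ : B)
    · -- a * c = b, so b / a = c ∈ B (when a ≠ 0)
      have heq : (a : K) * (c : K) = (b : K) := congrArg Subtype.val hc
      by_cases ha0 : (a : K) = 0
      · -- a = 0 implies b = 0, contradiction with hb0
        simp only [ha0, zero_mul] at heq
        exact absurd heq.symm hb0
      · -- a ≠ 0, so b / a = c ∈ B
        have hba : b / a ∈ B := by
          have : b / a = (c : K) := by field_simp [ha0]; exact heq.symm
          rw [this]; exact c.2
        -- So x⁻¹ = (a/b)⁻¹ = b/a ∈ B ⊆ O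
        rw [hxab] at hxB
        have hinvB : (a / b)⁻¹ ∈ B := by rw [inv_div]; exact hba
        have hinvO : (a / b)⁻¹ ∈ O := hBO hinvB
        -- a / b and (a/b)⁻¹ both in O, so a/b is a unit of O
        have hx0 : a / b ≠ 0 := by
          intro h0
          rw [div_eq_zero_iff] at h0
          rcases h0 with ha0' | hb0'
          · exact ha0 ha0'
          · exact hb0 hb0'
        have habO : a / b ∈ O := hxab ▸ hxO
        have hunit_O : O.valuation (a / b) = 1 := by
          have h1 : O.valuation (a / b) ≤ 1 := (O.valuation_le_one_iff _).mpr habO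
          have h2 : O.valuation ((a / b)⁻¹) ≤ 1 := (O.valuation_le_one_iff _).mpr hinvO
          rw [map_inv₀, inv_le_one₀ (zero_lt_iff.mpr ((Valuation.ne_zero_iff _).mpr hx0))] at h2
          exact le_antisymm h1 h2
        -- By domination: (a/b)⁻¹ is invertible in O (since a/b ∈ O), so (a/b)⁻¹ is invertible in B
        have : (a / b)⁻¹⁻¹ ∈ B := hdom.2 (a / b)⁻¹ hinvB (by rwa [inv_inv])
        rw [inv_inv] at this
        exact absurd this hxB
    · -- b * c = a, so a / b = c ∈ B, contradiction
      have heq : (b : K) * (c : K) = (a : K) := congrArg Subtype.val hc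
      have hab : a / b ∈ B := by
        have : a / b = (c : K) := by field_simp [hb0]; exact heq.symm
        rw [this]; exact c.2
      rw [hxab] at hxB
      exact absurd hab hxB

/-- **Derivation preservation transfers from model to divisorial ring.** If `s · D` preserves `B`,
and `O₁.toSubring = locAtCentre B O₁` (the divisorial ring is the localization of the model at its
centre), then `s · D` preserves `O₁`. This combines `mul_derivation_mem_locAtCentre` with the
equality `locAtCentre_eq_of_DVR`. [folklore] -/
theorem mul_derivation_mem_of_isLocalization (D : Derivation ℤ K K) (s : K)
    {B : Subring K} {O₁ : ValuationSubring K}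
    (hD : ∀ y ∈ B, s * D y ∈ B) (heq : O₁.toSubring = locAtCentre B O₁) :
    ∀ y ∈ O₁, s * D y ∈ O₁ := by
  intro y hy
  -- y ∈ O₁.toSubring = locAtCentre B O₁
  have hy' : y ∈ locAtCentre B O₁ := by rw [← heq]; exact hy
  have hmem : s * D y ∈ locAtCentre B O₁ := mul_derivation_mem_locAtCentre D s hD y hy'
  -- s * D y ∈ locAtCentre B O₁ = O₁.toSubring
  rw [← heq] at hmem
  exact hmem

/-! ## O2: No best residue approximation in the inert branch -/

/-- **No best residue approximation in the inert branch** (characteristic `p`): if `g₀ - a^p = c^p · u` with `c ≠ 0`, `u ∈ O₁` is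
residually not a `p`-th power (the inert hypothesis: `∀ d ∈ O₁, O₁.valuation (u - d^p) ≥ 1`), and `g₀` has no best `p`-th-power
approximation for `O`, then every `d ∈ O₁` has a strict improvement `d' ∈ O₁` with `O.valuation (u - d'^p) < O.valuation (u - d^p)`.
The defect lives on the residue field of `O₁`. [folklore] -/
theorem no_best_residue_approx (p : ℕ) [hp : Fact p.Prime] [CharP K p]
    (O O₁ : ValuationSubring K) (hO : O ≤ O₁)
    (g₀ a c u : K) (hc : c ≠ 0) (hu_eq : g₀ - a ^ p = c ^ p * u)
    (hu_mem : u ∈ O₁)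
    (hres : ∀ d : K, d ∈ O₁ → ¬ O₁.valuation (u - d ^ p) < 1)
    (hdefect : ∀ f₀ : K, ∃ f₁ : K, O.valuation (g₀ - f₁ ^ p) < O.valuation (g₀ - f₀ ^ p)) :
    ∀ d : K, d ∈ O₁ → ∃ d' : K, d' ∈ O₁ ∧ O.valuation (u - d' ^ p) < O.valuation (u - d ^ p) := by
  intro d hd
  -- By exists_lt_approx_of_generator, hdefect for g₀ implies hdefect for u
  have hdefect_u : ∀ e : K, ∃ e' : K, O.valuation (u - e' ^ p) < O.valuation (u - e ^ p) :=
    exists_lt_approx_of_generator p O g₀ a c u hc hu_eq hdefect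
  -- Get the improvement of d
  obtain ⟨d', hd'⟩ := hdefect_u d
  -- By mem_of_valuation_sub_pow_lt, d' ∈ O₁
  have hd'_mem : d' ∈ O₁ := mem_of_valuation_sub_pow_lt p O O₁ hO u hu_mem hres d hd d' hd'
  exact ⟨d', hd'_mem, hd'⟩

end Summit.ResolutionOfSingularities.ResolutionOfSingularities.Theorems.RadicialJung.CleanModels

end
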